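import Summits.QuantumFields.BalabanUV.T4Continuum.Spine.NE3.LandauProjectionB8
import Summits.QuantumFields.BalabanUV.T4Continuum.Support.NE3SmoothRightInverseW
import Summits.QuantumFields.BalabanUV.T4Continuum.Support.NE3CurlOfGaugeDir
import HarnessLib

/-!
# T⁴ programme, node NE3 — REPAIR R24 (γ3), finding F5: THE SUP LETTER OF THE LANDAU PROJECTION AS A NAMED HYPOTHESIS SHAPE — `LandauCorrectionSupB8`:
# for the lift of the solved datum `Y = covLift (L^{j+1}) W (ext((1+K)⁻¹ res φ))` and its (1.38)-Landau correction `λ ∈ N(Q′(W))`, `sup‖λ‖ ≤ K₀·sup‖φ‖` and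
# `sup‖gaugeDir W λ‖ ≤ K₁·sup‖φ‖∕L^{j+1}` — the [Balaban1985BackgroundPropagators] (3.42)∕(3.48) TYPE the chart's (J1) currency needs; its kinematic consequence for the
# window sup-curl (`≤ 2x_W·K₀·sup‖φ‖`)

Cell `pub-balaban-gaps` (YM blitz, track G2, seat `ne3`, unit `pub-balaban-gaps-ne3`; writer prover-pub-balaban-gaps-ne3-g3-0, 2026-08-23), census
`run/shared/lean/pub/pub-balaban-gaps/ne/NE3.md` §4 R24γ3, §9 F5.  WHY A SHAPE.  The supplier `Spine/NE3/SupplierB8.decomposedRepT_slicB8_of_landauRepB8Avg` needs, of its Landau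
linear normal part `Nn = Y + gaugeDir W λ`, the sup `αN` (with `(α+αN)·L^{j+1} ≤ 1`) and the window sup-curl `aN`; every ℓ²∕ℓ¹ letter of `Nn` is in kernel
(`Spine/NE3/NormalPartB8`, `NormalPartB8L1`), and `Y`'s sup is `liftC·sup‖φ‖∕(M(1−θ))` (`QbarRightInverseB8.covLift_solveW_R5`), but the correction `λ` solves a GLOBAL elliptic
system on the `(N·L^{j+1})`-torus (`Δ_W λ` determined through the projection onto `Δ_W N(Q′(W))`): its k-uniform sup control is a Green's-function estimate with decay —
[Balaban1985BackgroundPropagators] Thm 3.1∕3.3 (3.42) (`sup_{Δ(y)} |Gλ|, |∇_U Gλ|, …` with `e^{−δ₀d(y,y′)}`, Hölder currency (3.43)∕(3.45)) and Thm 3.2 (3.48)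
(`(Q′G′²Q′*)⁻¹` kernel decay) — exactly the operators with which [Balaban1985RegularSpaces] Sects. C–E construct the Landau gauge of Thm 2.  NOT kinematic (ℓ² → sup costs
`(N·L^{j+1})^{d∕2}`; flat Green kernels cost `log L^{j+1}`); typed here as a per-background hypothesis SHAPE on OUR objects, asserted for nothing.

CONTENT (0 sorry; ONE `def … : Prop` [hypothesis shape, review lane]): §1 **`LandauCorrectionSupB8 hL j hWu hx hs hWx N hθ K₀ K₁`**; §2 `LandauCorrectionSupB8.mono` (monotone in the
constants), **`LandauCorrectionSupB8.norm_curl_gaugeDir_le`** (the window sup-curl of the correction: `‖curl_W (gaugeDir W λ) p‖ ≤ 2x_W·K₀·s`, kinematic from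
`NE3CurlOfGaugeDir.norm_curlAt_gaugeDir_le`), `LandauCorrectionSupB8.norm_normalPart_le` (the sup of `Nn = Y + gaugeDir W λ`: `≤ (liftC∕(1−θ) + K₁)·s∕L^{j+1}`).

HONEST FRAMING.  A hypothesis SHAPE (printed-TYPE: [B9] (3.42)∕(3.48) read for the lineage's lift; the reading is ours) and two kinematic consequences; NOT proved for any background;
nothing about Bałaban's minimisers; the chart supplier's sup letters are exactly this shape; Π-REG, (P♮), (RES♯), the covariant root and **NE3 are NOT proved**; spine PROVED 0∕9;
finite T⁴ rung (B)+1 — NOT infinite volume, NOT mass gap, NOT `BetaPertH`, NOT Clay.  ABSOLUTE RULE kept: no printed sentence is a hypothesis of a theorem — the shape is a `def`,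
taken BY NAME.  PLACEMENT: `Summits/QuantumFields/BalabanUV/T4Continuum/Spine/NE3/`; imports accepted modules only; moves nothing.  HONEST DEPENDENCY: continuum YM on T⁴ ⇐
BetaPertH ∧ nine spine estimates (0/9 proved); BetaPertH ⇐ (D1) ∧ (D4) ∧ CAP+tail; G-an2-4 gates asym, D1 and NE2/3/4.
-/

set_option autoImplicit false

open scoped BigOperators Matrix Matrix.Norms.L2Operator
open NormedSpace Finset

namespace Summit.QuantumFields.BalabanUV.T4Continuum.NE3.LandauProjectionSupShape

open Literature.MathematicalPhysics.QuantumFieldTheory.Balaban1983to89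
open B7Prop1Explicit B7Prop2Explicit
open T4AveragingDeficitWall (Ad IsUnitaryCfg IsSkewDir SmallField curl curlAt)
open T4AveragingDeficitWallBoundary (IsPeriodicCfg periodBox)
open AveragingDeficitPeriodicCounting (IsPeriodicDir)
open AveragingDeficitTwoLevelPrep (skewSub)
open AveragingDeficitMultiLevelPrep (LevelSmall)
open AveragingDeficitTorusChart (TDir extDir resDir)
open BlockAveragePushDirGauge (gaugeDir)
open NE3CovariantLift (covLift)
open NE3QbarIterCovLiftPrep (cruxC liftC liftC_nonneg)
open NE3SmoothRightInverseW (solveW resSkew)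
open NE3CurlOfGaugeDir (norm_curlAt_gaugeDir_le)
open NE3.PairLandauB8 (avgKernelGauges IsLandauB8)

noncomputable section

variable {d : ℕ} {n : Type*} [Fintype n] [DecidableEq n]

/-! ## §1 The shape -/

/-- **`LandauCorrectionSupB8` — THE SUP LETTER OF THE LANDAU PROJECTION ON B8's SURFACE, AS A HYPOTHESIS SHAPE** (background `W` unitary in the level-`j` small-field class with the
solve smallness `θ = cruxC·(L^{j+1})²·x < 1`; constants `K₀, K₁`).  For every skew `N`-periodic coarse field `φ` with `‖φ‖_∞ ≤ s`, and every generator `λ ∈ N(Q′(W))`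
(`avgKernelGauges L N (j+1) W`) such that the lift of the solved datum corrected by `λ`, `covLift (L^{j+1}) W (ext((1+K)⁻¹ res φ)) + gaugeDir W λ`, is (1.38)-Landau
(`IsLandauB8`): `‖λ(y)‖ ≤ K₀·s` at every site and `‖gaugeDir W λ (y,μ)‖ ≤ K₁·s∕L^{j+1}` at every bond.  (Such `λ` exists — `LandauProjectionB8.exists_landauB8_correction` — and is
unique: `Δ_W` is injective on `N(Q′(W))`.)  Printed TYPE: [Balaban1985BackgroundPropagators] Thm 3.1∕3.3 (3.42), Thm 3.2 (3.48) (Green's-function sup-and-decay bounds for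
`G′(U₀)`, `(Q′G′²Q′*)⁻¹`, Hölder currency), read for the lineage's lift — the reading is ours; asserted for NOTHING. [folklore] -/
@[folklore]
def LandauCorrectionSupB8 [Nonempty n] {L : ℕ} (hL : 2 ≤ L) (j : ℕ) {W : Site d → Fin d → (Matrix n n ℂ)ˣ} {x : ℝ} (hWu : IsUnitaryCfg W) (hx : 0 ≤ x)
    (hs : LevelSmall d L j x) (hWx : SmallField W x) (N : ℕ) [NeZero N] (hθ : cruxC d L * (((L : ℝ) ^ (j + 1)) ^ 2 * x) < 1) (K₀ K₁ : ℝ) : Prop :=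
  ∀ ⦃φ : Site d → Fin d → Matrix n n ℂ⦄ (hφ : IsSkewDir φ), IsPeriodicDir φ (N : ℤ) →
    ∀ ⦃s : ℝ⦄, 0 ≤ s → (∀ (z : Site d) (κ : Fin d), ‖φ z κ‖ ≤ s) →
    ∀ ⦃lam : Site d → Matrix n n ℂ⦄, lam ∈ avgKernelGauges (d := d) (n := n) L N (j + 1) W →
      IsLandauB8 (d := d) L N (j + 1) W
        (fun y κ => covLift (L ^ (j + 1)) W (extDir N ((solveW hL j hWu hx hs hWx N hθ (resSkew N hφ) : ↥(skewSub d n N)) : TDir d n N)) y κ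
          + gaugeDir W lam y κ) →
      (∀ y : Site d, ‖lam y‖ ≤ K₀ * s) ∧ (∀ (y : Site d) (μ : Fin d), ‖gaugeDir W lam y μ‖ ≤ K₁ * s / (L : ℝ) ^ (j + 1))

/-! ## §2 Bookkeeping and the kinematic consequences for the supplier's sup currencies -/

section Shape

variable [Nonempty n] {L : ℕ} (hL : 2 ≤ L) (j : ℕ) {W : Site d → Fin d → (Matrix n n ℂ)ˣ} {x : ℝ} (hWu : IsUnitaryCfg W) (hx : 0 ≤ x)
  (hs : LevelSmall d L j x) (hWx : SmallField W x) (N : ℕ) [NeZero N] (hθ : cruxC d L * (((L : ℝ) ^ (j + 1)) ^ 2 * x) < 1)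

/-- Monotonicity in the constants. [folklore] -/
theorem LandauCorrectionSupB8.mono {K₀ K₁ K₀' K₁' : ℝ} (h : LandauCorrectionSupB8 hL j hWu hx hs hWx N hθ K₀ K₁) (h₀ : K₀ ≤ K₀') (h₁ : K₁ ≤ K₁') :
    LandauCorrectionSupB8 hL j hWu hx hs hWx N hθ K₀' K₁' := by
  intro φ hφ hφP s hs0 hφs lam hlam hLan
  obtain ⟨hl, hD⟩ := h hφ hφP hs0 hφs hlam hLan
  have hL0 : (0 : ℝ) < (L : ℝ) ^ (j + 1) := by positivity
  refine ⟨fun y => (hl y).trans (mul_le_mul_of_nonneg_right h₀ hs0), fun y μ => (hD y μ).trans ?_⟩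
  exact div_le_div_of_nonneg_right (mul_le_mul_of_nonneg_right h₁ hs0) hL0.le

/-- **THE WINDOW SUP-CURL OF THE CORRECTION, FROM THE SHAPE** (kinematic): the curl of a pure-gauge direction is the commutator with the plaquette variable, so
`‖curl_W (gaugeDir W λ) p‖ ≤ 2x_W·‖λ(p.1)‖ ≤ 2x_W·K₀·s` (`NE3CurlOfGaugeDir.norm_curlAt_gaugeDir_le`) — the `aN`-currency of the correction summand. [folklore] -/
theorem LandauCorrectionSupB8.norm_curl_gaugeDir_le {K₀ K₁ : ℝ} (h : LandauCorrectionSupB8 hL j hWu hx hs hWx N hθ K₀ K₁)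
    {φ : Site d → Fin d → Matrix n n ℂ} (hφ : IsSkewDir φ) (hφP : IsPeriodicDir φ (N : ℤ)) {s : ℝ} (hs0 : 0 ≤ s) (hφs : ∀ (z : Site d) (κ : Fin d), ‖φ z κ‖ ≤ s)
    {lam : Site d → Matrix n n ℂ} (hlam : lam ∈ avgKernelGauges (d := d) (n := n) L N (j + 1) W)
    (hLan : IsLandauB8 (d := d) L N (j + 1) W
      (fun y κ => covLift (L ^ (j + 1)) W (extDir N ((solveW hL j hWu hx hs hWx N hθ (resSkew N hφ) : ↥(skewSub d n N)) : TDir d n N)) y κ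
        + gaugeDir W lam y κ)) (p : T4AveragingDeficitWall.Plaq d) :
    ‖curl W (gaugeDir W lam) p‖ ≤ 2 * x * (K₀ * s) := by
  obtain ⟨hl, -⟩ := h hφ hφP hs0 hφs hlam hLan
  have h1 : ‖curl W (gaugeDir W lam) p‖ ≤ 2 * x * ‖lam p.1‖ := norm_curlAt_gaugeDir_le hWu hWx lam p.1 (ne_of_lt p.2.2)
  exact h1.trans (mul_le_mul_of_nonneg_left (hl p.1) (by positivity))

/-- **THE SUP OF THE NORMAL PART `Nn = Y + gaugeDir W λ`, FROM THE SHAPE**: with `Y`'s sup letter `‖Y‖ ≤ liftC∕(L^{j+1}(1−θ))·s` (`QbarRightInverseB8.covLift_solveW_R5`, here a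
hypothesis to keep the imports light) and the shape's `‖gaugeDir W λ‖ ≤ K₁·s∕L^{j+1}`: `‖Nn(y,μ)‖ ≤ (liftC∕(1−θ) + K₁)·s∕L^{j+1}` — the `αN`-currency, k-free in `αN·L^{j+1}`.
[folklore] -/
theorem LandauCorrectionSupB8.norm_normalPart_le {K₀ K₁ : ℝ} (h : LandauCorrectionSupB8 hL j hWu hx hs hWx N hθ K₀ K₁)
    {φ : Site d → Fin d → Matrix n n ℂ} (hφ : IsSkewDir φ) (hφP : IsPeriodicDir φ (N : ℤ)) {s : ℝ} (hs0 : 0 ≤ s) (hφs : ∀ (z : Site d) (κ : Fin d), ‖φ z κ‖ ≤ s)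
    {lam : Site d → Matrix n n ℂ} (hlam : lam ∈ avgKernelGauges (d := d) (n := n) L N (j + 1) W)
    (hLan : IsLandauB8 (d := d) L N (j + 1) W
      (fun y κ => covLift (L ^ (j + 1)) W (extDir N ((solveW hL j hWu hx hs hWx N hθ (resSkew N hφ) : ↥(skewSub d n N)) : TDir d n N)) y κ
        + gaugeDir W lam y κ))
    (hY : ∀ (y : Site d) (μ : Fin d),
      ‖covLift (L ^ (j + 1)) W (extDir N ((solveW hL j hWu hx hs hWx N hθ (resSkew N hφ) : ↥(skewSub d n N)) : TDir d n N)) y μ‖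
        ≤ liftC d / ((L : ℝ) ^ (j + 1) * (1 - cruxC d L * (((L : ℝ) ^ (j + 1)) ^ 2 * x))) * s)
    (y : Site d) (μ : Fin d) :
    ‖covLift (L ^ (j + 1)) W (extDir N ((solveW hL j hWu hx hs hWx N hθ (resSkew N hφ) : ↥(skewSub d n N)) : TDir d n N)) y μ + gaugeDir W lam y μ‖
      ≤ (liftC d / (1 - cruxC d L * (((L : ℝ) ^ (j + 1)) ^ 2 * x)) + K₁) * s / (L : ℝ) ^ (j + 1) := by
  obtain ⟨-, hD⟩ := h hφ hφP hs0 hφs hlam hLan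
  have hL0 : (0 : ℝ) < (L : ℝ) ^ (j + 1) := by positivity
  have hpos : 0 < 1 - cruxC d L * (((L : ℝ) ^ (j + 1)) ^ 2 * x) := by linarith
  refine (norm_add_le _ _).trans ((add_le_add (hY y μ) (hD y μ)).trans (le_of_eq ?_))
  field_simp

end Shape

end

end Summit.QuantumFields.BalabanUV.T4Continuum.NE3.LandauProjectionSupShape
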